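import Summits.HodgeConjecture.HodgeConjecture.Theses.AnchorTransport
import Summits.HodgeConjecture.HodgeConjecture.Theorems.AnchorTransportVariationalHodgeReductions
import Literature.AlgebraicGeometry.HodgeTheory.MotivatedClassesLefschetzRange
import Literature.AlgebraicGeometry.HodgeTheory.TopDegreeClasses
import Literature.AlgebraicGeometry.HodgeTheory.HodgeConjecture

/-!
# Route AnchorTransport — `VariationalHodge` (stmt-HodgeConjecture-1076): the Lefschetz range of codimensions

The crux `AnchorTransport.VariationalHodge` (Grothendieck's variational Hodge conjecture in global-class
form: `f : 𝒳 ⟶ S` a smooth projective family of relative dimension `n` over a smooth irreducible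
`ℂ`-scheme, `A ∈ H²ᵖ(𝒳(ℂ); ℂ)` with every fibre restriction rational of type `(p, p)`, algebraic at one
complex point ⇒ algebraic at every complex point) has, in each codimension `p`, exactly the strength of
the Hodge conjecture in codimension `p` on the fibres concerned (`variationalHodge_conclusion_of_fibre`:
the anchor, irreducibility and smoothness of the base are then idle). This file cashes the KNOWN cases of
the Hodge conjecture on the fibres — every fibre `𝒳_s` is a smooth projective complex `n`-fold
(`IsSmoothProjectiveFamily.isSmoothProjective`):

* `variationalHodge_conclusion_top` — codimension `p = n ≥ 1`: UNCONDITIONAL (`H²ⁿ` is spanned by the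
  class of a point, the tree's proved `mem_algebraicClasses_of_degree_top`);
* `variationalHodge_conclusion_of_lefschetzRange` — `p ≤ 1` or `p ≥ n - 1`, granted the two classical
  Lefschetz theorems as the tree's named facts `lefschetzOneOne_rational` (Voisin I, Thm. 11.30) and
  `nonempty_hardLefschetzNFold` (Voisin I, Thm. 6.25) through the proved
  `mem_algebraicClasses_of_lefschetzRange`;
* `variationalHodge_of_dim_le_three` — hence the crux holds outright for families of curves, surfaces
  and threefolds (every `p` is in the Lefschetz range when `n ≤ 3`), granted the same two facts;
* `variationalHodge_of_middleRange` — and **the crux is its own restriction to the middle range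
  `2 ≤ p ≤ n - 2` (so `n ≥ 4`)**, granted the same two facts: the first open case is `p = 2` on
  families of fourfolds (Charles–Schnell, *Notes on absolute Hodge classes*, remark before Prop. 11.3.5:
  "very little seems to be known"; Thomas, *Nodes and the Hodge conjecture*, §5).

Nothing here uses the anchor: these are the degrees in which the crux carries no variational content.
-/

noncomputable section

-- every declaration of this problem lives in `Summit.HodgeConjecture.HodgeConjecture.…` (summit = sub-problem)
set_option linter.dupNamespace false

open CategoryTheory AlgebraicGeometry
open Literature.AlgebraicGeometry.Motives Literature.AlgebraicGeometry.HodgeTheory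
open Summit.HodgeConjecture.HodgeConjecture.Theses.AnchorTransport

namespace Summit.HodgeConjecture.HodgeConjecture.Theorems

variable {n : ℕ} {𝒳 S : SchemeOver ℂ} (f : 𝒳 ⟶ S)

/-! ### Fibrewise Hodge conjecture ⇒ the conclusion of the crux -/

/-- **The conclusion of the crux at `s` follows from the Hodge conjecture in codimension `p` on the one
fibre `𝒳_s`** (applied to the rational `(p,p)` class `A|_{𝒳_s}`); the anchor and the base play no role.
This is the pointwise form of `variationalHodge_of_hodgeConjecture` (Charles–Schnell, Cor. 11.3.6).
[folklore] -/
theorem variationalHodge_conclusion_of_fibre {p : ℕ} (A : complexBetti 𝒳 (2 * p)) (s : ComplexPoints S)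
    (hHC : ∀ c : complexBetti (fiberOver f s) (2 * p), IsRationalClass c →
      IsOfHodgeType n (fiberOver f s) (2 * p) p p c → c ∈ algebraicClasses (fiberOver f s) p)
    (hA : IsRationalClass (complexBetti.map (fiberι f s) (2 * p) A) ∧
      IsOfHodgeType n (fiberOver f s) (2 * p) p p (complexBetti.map (fiberι f s) (2 * p) A)) :
    complexBetti.map (fiberι f s) (2 * p) A ∈ algebraicClasses (fiberOver f s) p :=
  hHC _ hA.1 hA.2

/-- The same with the fibrewise Hodge conjecture packaged as the summit layer's `HodgeConjectureFor`.
[folklore] -/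
theorem variationalHodge_conclusion_of_hodgeConjectureFor {p : ℕ} (A : complexBetti 𝒳 (2 * p))
    (s : ComplexPoints S) (hHC : HodgeConjectureFor n (fiberOver f s))
    (hA : IsRationalClass (complexBetti.map (fiberι f s) (2 * p) A) ∧
      IsOfHodgeType n (fiberOver f s) (2 * p) p p (complexBetti.map (fiberι f s) (2 * p) A)) :
    complexBetti.map (fiberι f s) (2 * p) A ∈ algebraicClasses (fiberOver f s) p :=
  variationalHodge_conclusion_of_fibre f A s (hHC.2 p) hA

/-! ### The top degree: unconditional -/

/-- **Codimension `p = n ≥ 1`**: the conclusion of the crux holds for every smooth projective family of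
relative dimension `n` and every class, with no rationality or Hodge-type hypothesis, because
`H²ⁿ(𝒳_s(ℂ); ℂ) = ℂ · [pt]` is spanned by an algebraic class (the tree's proved
`mem_algebraicClasses_of_degree_top`). [folklore] -/
theorem variationalHodge_conclusion_top (hf : IsSmoothProjectiveFamily f n) (hn : 1 ≤ n)
    (A : complexBetti 𝒳 (2 * n)) (s : ComplexPoints S) :
    complexBetti.map (fiberι f s) (2 * n) A ∈ algebraicClasses (fiberOver f s) n :=
  mem_algebraicClasses_of_degree_top (hf.isSmoothProjective s) hn _

/-! ### The Lefschetz range `p ≤ 1 ∨ n ≤ p + 1` -/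

/-- **The conclusion of the crux in the Lefschetz range of codimensions** `p ≤ 1` or `p ≥ n - 1`, for
every smooth projective family, every class with rational `(p,p)` restriction at `s`, and every `s`:
granted Lefschetz `(1,1)` (`hL`, Voisin I Thm. 11.30) and hard Lefschetz for the fibre (`hHL`, Voisin I
Thm. 6.25), rational `(p,p)`-classes on the smooth projective `n`-fold `𝒳_s` are algebraic in these
codimensions (`mem_algebraicClasses_of_lefschetzRange`). No anchor is used.
[cite: VoisinHodgeI2002, Thm. 6.25, Rem. 6.27, §7.1.2 and Thm. 11.30] [cite: Murre1977, Remark 1] -/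
theorem variationalHodge_conclusion_of_lefschetzRange (hL : lefschetzOneOne_rational)
    (hf : IsSmoothProjectiveFamily f n) {p : ℕ} (hp : p ≤ 1 ∨ n ≤ p + 1) (A : complexBetti 𝒳 (2 * p))
    (s : ComplexPoints S) (hHL : nonempty_hardLefschetzNFold n (fiberOver f s))
    (hA : IsRationalClass (complexBetti.map (fiberι f s) (2 * p) A) ∧
      IsOfHodgeType n (fiberOver f s) (2 * p) p p (complexBetti.map (fiberι f s) (2 * p) A)) :
    complexBetti.map (fiberι f s) (2 * p) A ∈ algebraicClasses (fiberOver f s) p :=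
  mem_algebraicClasses_of_lefschetzRange hL hHL (hf.isSmoothProjective s) hp _ hA.1 hA.2

/-- **Codimension one**: the conclusion of the crux for `p = 1` is Lefschetz's theorem on
`(1,1)`-classes on the fibre `𝒳_s` (`hL`), for every family and every `s`; no anchor, no hard Lefschetz.
[cite: VoisinHodgeI2002, Thm. 11.30 and §11.3.3] -/
theorem variationalHodge_conclusion_one (hL : lefschetzOneOne_rational) (hf : IsSmoothProjectiveFamily f n)
    (A : complexBetti 𝒳 (2 * 1)) (s : ComplexPoints S)
    (hA : IsRationalClass (complexBetti.map (fiberι f s) (2 * 1) A) ∧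
      IsOfHodgeType n (fiberOver f s) (2 * 1) 1 1 (complexBetti.map (fiberι f s) (2 * 1) A)) :
    complexBetti.map (fiberι f s) (2 * 1) A ∈ algebraicClasses (fiberOver f s) 1 :=
  hL (hf.isSmoothProjective s) _ hA.1 hA.2

/-! ### Consequences for the crux -/

/-- **The variational Hodge crux for families of curves, surfaces and threefolds** (`n ≤ 3`), granted
Lefschetz `(1,1)` and hard Lefschetz on the fibres: for `n ≤ 3` every codimension `p` lies in the
Lefschetz range `p ≤ 1 ∨ n ≤ p + 1`, where the Hodge conjecture holds on each fibre (Voisin II, proof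
of Prop. 10.26: "as `X'` is of dimension `≤ 3`, the rational Hodge conjecture holds … in every degree").
[cite: VoisinHodgeII2003, §10.2.3 proof of Prop. 10.26] [cite: VoisinHodgeI2002, Thm. 6.25 and Thm. 11.30] -/
theorem variationalHodge_of_dim_le_three (hL : lefschetzOneOne_rational)
    (hHL : ∀ (m : ℕ) (Y : SchemeOver ℂ), nonempty_hardLefschetzNFold m Y)
    ⦃n : ℕ⦄ (hn : n ≤ 3) ⦃𝒳 S : SchemeOver ℂ⦄ (f : 𝒳 ⟶ S) (hf : IsSmoothProjectiveFamily f n) (p : ℕ)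
    (A : complexBetti 𝒳 (2 * p))
    (hA : ∀ s : ComplexPoints S, IsRationalClass (complexBetti.map (fiberι f s) (2 * p) A) ∧
      IsOfHodgeType n (fiberOver f s) (2 * p) p p (complexBetti.map (fiberι f s) (2 * p) A))
    (s : ComplexPoints S) :
    complexBetti.map (fiberι f s) (2 * p) A ∈ algebraicClasses (fiberOver f s) p :=
  variationalHodge_conclusion_of_lefschetzRange f hL hf (by omega) A s (hHL _ _) (hA s)

/-- **The crux is its own restriction to the middle range of codimensions `2 ≤ p ≤ n - 2`** (hence to
relative dimension `n ≥ 4`), granted Lefschetz `(1,1)` (`hL`) and hard Lefschetz (`hHL`) on the fibres: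
outside that range the conclusion holds fibre by fibre (`variationalHodge_conclusion_of_lefschetzRange`).
The first open case is `p = 2` on families of fourfolds. [cite: VoisinHodgeI2002, Thm. 6.25 and Thm. 11.30]
[cite: Murre1977, Remark 1] -/
theorem variationalHodge_of_middleRange (hL : lefschetzOneOne_rational)
    (hHL : ∀ (m : ℕ) (Y : SchemeOver ℂ), nonempty_hardLefschetzNFold m Y)
    (h : ∀ ⦃n : ℕ⦄ ⦃𝒳 S : SchemeOver ℂ⦄ (f : 𝒳 ⟶ S), IsSmoothProjectiveFamily f n →
      IrreducibleSpace S.left → AlgebraicGeometry.Smooth S.hom →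
      ∀ (p : ℕ), 2 ≤ p → p + 2 ≤ n → ∀ (A : complexBetti 𝒳 (2 * p)),
      (∀ s : ComplexPoints S, IsRationalClass (complexBetti.map (fiberι f s) (2 * p) A) ∧
        IsOfHodgeType n (fiberOver f s) (2 * p) p p (complexBetti.map (fiberι f s) (2 * p) A)) →
      (∃ s₀ : ComplexPoints S,
        complexBetti.map (fiberι f s₀) (2 * p) A ∈ algebraicClasses (fiberOver f s₀) p) →
      ∀ s : ComplexPoints S,
        complexBetti.map (fiberι f s) (2 * p) A ∈ algebraicClasses (fiberOver f s) p) :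
    VariationalHodge := by
  intro n 𝒳 S f hf hirr hsm p A hA hs₀ s
  by_cases hp : p ≤ 1 ∨ n ≤ p + 1
  · exact variationalHodge_conclusion_of_lefschetzRange f hL hf hp A s (hHL _ _) (hA s)
  · exact h f hf hirr hsm p (by omega) (by omega) A hA hs₀ s

/-- **Middle range AND affine base at once**: the crux follows from its restriction to families of
relative dimension `n ≥ 4`, codimensions `2 ≤ p ≤ n - 2`, over smooth irreducible AFFINE bases
(`variationalHodge_of_middleRange` after `variationalHodge_of_affine`), granted the two Lefschetz facts.
[cite: VoisinHodgeI2002, Thm. 6.25 and Thm. 11.30] -/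
theorem variationalHodge_of_middleRange_of_affine (hL : lefschetzOneOne_rational)
    (hHL : ∀ (m : ℕ) (Y : SchemeOver ℂ), nonempty_hardLefschetzNFold m Y)
    (h : ∀ ⦃n : ℕ⦄ ⦃𝒳 S : SchemeOver ℂ⦄ (f : 𝒳 ⟶ S), IsSmoothProjectiveFamily f n →
      IrreducibleSpace S.left → IsAffine S.left → AlgebraicGeometry.Smooth S.hom →
      ∀ (p : ℕ), 2 ≤ p → p + 2 ≤ n → ∀ (A : complexBetti 𝒳 (2 * p)),
      (∀ s : ComplexPoints S, IsRationalClass (complexBetti.map (fiberι f s) (2 * p) A) ∧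
        IsOfHodgeType n (fiberOver f s) (2 * p) p p (complexBetti.map (fiberι f s) (2 * p) A)) →
      (∃ s₀ : ComplexPoints S,
        complexBetti.map (fiberι f s₀) (2 * p) A ∈ algebraicClasses (fiberOver f s₀) p) →
      ∀ s : ComplexPoints S,
        complexBetti.map (fiberι f s) (2 * p) A ∈ algebraicClasses (fiberOver f s) p) :
    VariationalHodge := by
  refine variationalHodge_of_affine fun n 𝒳 S f hf hirr haff hsm p A hA hs₀ s => ?_
  by_cases hp : p ≤ 1 ∨ n ≤ p + 1
  · exact variationalHodge_conclusion_of_lefschetzRange f hL hf hp A s (hHL _ _) (hA s)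
  · exact h f hf hirr haff hsm p (by omega) (by omega) A hA hs₀ s

end Summit.HodgeConjecture.HodgeConjecture.Theorems

end
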